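import Summits.CriticalPhenomena.SAWScalingLimit.Theses.SAWLoopFugacityFlow
import Summits.CriticalPhenomena.SAWScalingLimit.Theorems.SimpleSubseqLimits.Negative.SimpleSubseqLimitsNecessary
import Summits.CriticalPhenomena.SAWScalingLimit.Theorems.SAWLoopFugacityFlowAvoidanceDeterminesLaw
import HarnessLib

/-!
# `SAWLoopFugacityFlow.LimitAvoidanceValues` (stmt-CriticalPhenomena-18170): where the support item sits

The item says: every subsequential weak limit `ν` of the pushed-forward critical SAW laws along an
endpoint approximation of a Dobrushin domain `(D; a, b)` has the hull-avoidance values of SOME chordal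
SLE_(8/3) law `μ` of `D`.  Mathematically this is the restriction content of the Lawler–Schramm–Werner
prediction for subsequential limits, an open problem; inside the route it is delivered by the A-side
(`SlitSplit.limitAvoidanceValues_of_avoidanceLimit : AvoidanceLimit → LimitAvoidanceValues`, landed in
`Theorems/SAWLoopFugacityFlowSimpleSubseqLimitsSplit.lean`).  This helper file records, sorry-free and
from landed theorems only, the remaining arrows around the item:

* `limitAvoidanceValues_of_subseqIdentification` — identified limits carry their own values
  (`SubseqIdentification → LimitAvoidanceValues`, witness `μ := ν`);
* `limitAvoidanceValues_of_sawScalingLimit` — **the item is NECESSARY for the summit conjunct**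
  (`SAWScalingLimit → LimitAvoidanceValues`): under convergence in law to SLE_(8/3) every weak
  subsequential limit IS the SLE law (`Negative.isSLELaw_of_weakLimit`, uniqueness of weak limits), so a
  refutation of the item would refute `SAWScalingLimit` as typed (`not_sawScalingLimit_of_not_limitAvoidanceValues`);
* `subseqIdentification_of_limitAvoidanceValues` — conversely, the item together with the parent crux
  `SimpleSubseqLimits` identifies every subsequential limit (`AvoidanceDeterminesLaw_proof` + the SLE
  carrier `Negative.ae_carrier_of_isSLELaw`), whence the exact position
  `subseqIdentification_iff : SubseqIdentification ↔ (LimitAvoidanceValues ∧ SimpleSubseqLimits)`.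

References: G. F. Lawler, O. Schramm, W. Werner, *Conformal restriction: the chordal case*, J. Amer.
Math. Soc. 16 (2003), §3 and Thm. 6.1; *On the scaling limit of planar self-avoiding walk*, Proc.
Sympos. Pure Math. 72 (2004), §4.1, Prediction 1.
-/

noncomputable section

open MeasureTheory Filter Topology Set
open Literature.Probability.RandomPlanarGeometry Literature.Probability.RandomPlanarGeometry.SAW
open Literature.Probability.LatticeModels
open scoped ENNReal NNReal BoundedContinuousFunction

namespace Summit.CriticalPhenomena.SAWScalingLimit.Theorems.LimitAvoidanceValues

open Summit.CriticalPhenomena.SAWScalingLimit.Theses.SAWLoopFugacityFlow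
  (LimitAvoidanceValues SubseqIdentification SimpleSubseqLimits)
open Summit.CriticalPhenomena.SAWScalingLimit.Theorems.SimpleSubseqLimits.Negative
  (ae_carrier_of_isSLELaw isSLELaw_of_weakLimit)
open Summit.CriticalPhenomena.SAWScalingLimit.Theorems.AvoidanceDeterminesLaw
  (AvoidanceDeterminesLaw_proof)

/-- **Identified limits carry SLE values**: if every subsequential weak limit of the critical SAW laws
is an SLE_(8/3) law (`SubseqIdentification`, stmt-CriticalPhenomena-0783), then it has the
hull-avoidance values of some SLE_(8/3) law — itself. [folklore] -/
theorem limitAvoidanceValues_of_subseqIdentification (hI : SubseqIdentification) :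
    LimitAvoidanceValues := by
  intro D a b hab s ν hs hν hw
  exact ⟨ν, hI D a b hab s ν hs hν hw, fun _ _ _ _ _ => rfl⟩

/-- **The item is necessary for the summit conjunct**: `SAWScalingLimit → LimitAvoidanceValues`.
Under convergence in law of the critical SAW to chordal SLE_(8/3) every weak subsequential limit is
that SLE law (weak limits of probability measures on `CurveClass ℂ` are unique), so it carries the
SLE_(8/3) hull-avoidance values. [folklore] -/
theorem limitAvoidanceValues_of_sawScalingLimit (hS : _root_.SAWScalingLimit) :
    LimitAvoidanceValues := by
  intro D a b hab s ν hs hν hw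
  haveI := hν
  exact ⟨ν, isSLELaw_of_weakLimit (hS D a b hab) hs hw, fun _ _ _ _ _ => rfl⟩

/-- **Refuting the item refutes the summit conjunct**: a subsequential limit of critical SAW whose
hull-avoidance values are those of no SLE_(8/3) law contradicts `SAWScalingLimit` as typed.
[folklore] -/
theorem not_sawScalingLimit_of_not_limitAvoidanceValues (h : ¬ LimitAvoidanceValues) :
    ¬ _root_.SAWScalingLimit :=
  fun hS => h (limitAvoidanceValues_of_sawScalingLimit hS)

/-- **Values + simplicity identify the limit**: if a subsequential weak limit `ν` has the
hull-avoidance values of an SLE_(8/3) law `μ` (the item) and is carried by simple chords from `a` to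
`b` meeting `∂D` only at `a`, `b` (the parent crux `SimpleSubseqLimits`), then `ν = μ` is an
SLE_(8/3) law: the SLE law is so carried (Rohde–Schramm, `Negative.ae_carrier_of_isSLELaw`) and
"avoidance determines the law" (`AvoidanceDeterminesLaw_proof`, LSW 2003 §3).
[cite: LawlerSchrammWerner2003Restriction, §3] -/
theorem subseqIdentification_of_limitAvoidanceValues (hV : LimitAvoidanceValues)
    (hSim : SimpleSubseqLimits) : SubseqIdentification := by
  intro D a b hab s ν hs hν hw
  obtain ⟨μ, hμ, hagree⟩ := hV D a b hab s ν hs hν hw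
  haveI : Fact Literature.Probability.Process.isProjectiveLimit_preWienerMeasure :=
    ⟨isProjectiveLimit_preWienerMeasure_holds⟩
  haveI := hμ.isProbabilityMeasure
  have hμν : μ = ν :=
    AvoidanceDeterminesLaw_proof D μ ν inferInstance hν (ae_carrier_of_isSLELaw hμ)
      (hSim D a b hab s ν hs hν hw) fun D' hsub h0 h1 hε => (hagree D' hsub h0 h1 hε).symm
  exact hμν ▸ hμ

/-- **Exact position of the item**: identification of subsequential limits
(`SubseqIdentification`, stmt-CriticalPhenomena-0783) is equivalent to the conjunction of the item
with its parent crux `SimpleSubseqLimits` (stmt-CriticalPhenomena-4982). [folklore] -/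
theorem subseqIdentification_iff :
    SubseqIdentification ↔ (LimitAvoidanceValues ∧ SimpleSubseqLimits) := by
  refine ⟨fun hI => ⟨limitAvoidanceValues_of_subseqIdentification hI, ?_⟩,
    fun h => subseqIdentification_of_limitAvoidanceValues h.1 h.2⟩
  intro D a b hab s ν hs hν hw
  exact ae_carrier_of_isSLELaw (hI D a b hab s ν hs hν hw)

end Summit.CriticalPhenomena.SAWScalingLimit.Theorems.LimitAvoidanceValues

end
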